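import Mathlib.LinearAlgebra.Matrix.Adjugate
import Mathlib.LinearAlgebra.Matrix.Trace
import Mathlib.Data.ZMod.Basic
import Mathlib.Algebra.CharP.Two
import Mathlib.Algebra.BigOperators.Ring.Finset

/-!
# Crux `CubicForrelation.NearExactIsExact` (stmt-QuantumAdvantage-14043) — n = 12, E1280-even: the SYMPLECTIC PAIRING PARITY
  `⟨M⁻¹, M⟩ = m` for a non-degenerate alternating `2m × 2m` matrix over `𝔽₂`

Certificate seat `b2b-cforr-cert` (gen 39).  HONEST FRAMING: a kernel-checked piece of linear algebra over `𝔽₂` (standard axioms).  It is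
the one non-elementary algebraic input ("Pfaffian parity") of the HAND proofs (HOME/b2b-cforr-cert-g39/E1280-HANDPROOFS.md) that replace the
exhaustive enumerations of the computer-assisted closure of the last open case "E1280-even" of the 12-bit window `(57/64, 29/32)`
(cert seats g36/g37: HOME/b2b-cforr-cert-g37/R2-PARTNER.md §4b, R4-PARTNER.md §4).  By itself it says nothing about `θ₁₂`; NOT summit progress.

THE STATEMENT (`tps_pairing_inverse_alternating`).  Let `M` be an alternating `n × n` matrix over `𝔽₂` (symmetric, zero diagonal),
`n = 2m`, and `B` a left inverse, `B M = 1`.  Then the canonical pairing of the bivector `B` with the 2-form `M` is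
`Σ_{i<j} B_{ij} M_{ij} = m (mod 2)`.  (In a symplectic basis `M⁻¹ = Σ_k a_k ∧ b_k`, so the pairing counts the `m` hyperbolic pairs;
equivalently `Σ_{i<j} M_{ij} Pf(M_{îĵ}) = m · Pf(M)`.)

THE PROOF formalised here avoids symplectic bases and Pfaffians: lift `M` to the SKEW-symmetric integer matrix `L` (`L_{ij} = M_{ij}`,
`L_{ji} = −M_{ij}` for `i < j`); `det L` is odd since it reduces to `det M = 1`; the adjugate `A = adj L` is skew-symmetric with zero
diagonal (`adj(Lᵀ) = adj(−L) = (−1)^{n−1} adj L`, `n` even) and reduces mod 2 to `adj M = M⁻¹ = B`; and over `ℤ`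
`2 Σ_{i<j} A_{ij} L_{ij} = Σ_{i,j} A_{ij} L_{ij} = −tr(A L) = −n·det L = −2m·det L`, so `Σ_{i<j} A_{ij} L_{ij} = −m·det L ≡ m (mod 2)`.

USED BY (hand proofs, to be formalised on top of the rank-2 / rank-4 frames): R2 descendant `T`, sub-case (a) (`⟨Γ_FF⁻¹, Γ_FF⟩ = 3 = 1`
contradicts the pairing equation at `(y₃, y₃)`), and R4 descendant `0`, hyperplane-section case with `rank Ξ = 6` (`N Ξ = 1 + r y₁ᵀ`
forces `⟨Ξ, N⟩ = 3 = 1`, contradicting the pairing equation at `(v₀, v₀)`).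

APPENDED (gen 39, same session): the CANONICAL PAIRING TOOLKIT `⟨X, Y⟩ = Σ_{i<j} X_{ij} Y_{ij}` (bivector `X`, 2-form `Y`, both given by
symmetric zero-diagonal matrices): `tps_pairing_wedge` (`⟨u∧v, Y⟩ = uᵀ Y v`), `tps_pairing_conj` (`⟨Q X Qᵀ, Y⟩ = ⟨X, Qᵀ Y Q⟩`, any commutative
ring), `tps_pairing_sum_sum` (bilinearity), `tps_conj_symm` / `tps_conj_diag_zero` (pull-backs of alternating forms are alternating over `𝔽₂`),
and `tps_pair_covariant`: the pairing-partner equations `Σ_{j<k} c_{pjk} d_{φjk} = [p = φ]` are preserved when the 3-form `d` is rewritten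
in a new linear frame `P` and the 3-vector `c` is transformed contravariantly — so "the cubic part of the digit class admits a pairing
partner" (…TwelveDigitPairing) can be used in the ADAPTED R2 / R4 frames of the light-cell analysis (E1280-HANDPROOFS.md §0, (L4)).

References: this work (cert seats g33–g39); for Pfaffians and alternating forms over `𝔽₂`: F. J. MacWilliams, N. J. A. Sloane (1977) Ch. 15 §2.
Axioms: the standard three.
-/

set_option linter.dupNamespace false -- D-0017: single-problem summit ⇒ `QuantumAdvantage.QuantumAdvantage` by design

namespace Summit.QuantumAdvantage.QuantumAdvantage.Theorems.CubicForrelation.NearExactIsExact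

open Finset Matrix

/-- Over `ℤ`: for matrices `A, L` with `A_{ji} = −A_{ij}`, `L_{ji} = −L_{ij}` and zero diagonals, the full double sum `Σ_{i,j} A_{ij} L_{ij}`
is twice the half sum `Σ_{i<j} A_{ij} L_{ij}`. [this work] -/
theorem tps_sum_eq_two_mul_half {n : ℕ} (A L : Matrix (Fin n) (Fin n) ℤ)
    (hA : ∀ i j, A j i = -A i j) (hL : ∀ i j, L j i = -L i j) (hAd : ∀ i, A i i = 0) :
    (∑ i, ∑ j, A i j * L i j) = 2 * ∑ i, ∑ j, (if i < j then A i j * L i j else 0) := by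
  have hsplit : ∀ i j, A i j * L i j = (if i < j then A i j * L i j else 0) + (if j < i then A i j * L i j else 0) := by
    intro i j
    rcases lt_trichotomy i j with h | h | h
    · rw [if_pos h, if_neg (lt_asymm h), add_zero]
    · subst h; rw [if_neg (lt_irrefl _), hAd, zero_mul, add_zero]
    · rw [if_neg (lt_asymm h), if_pos h, zero_add]
  have hswap : (∑ i, ∑ j, (if j < i then A i j * L i j else 0)) = ∑ i, ∑ j, (if i < j then A i j * L i j else 0) := by
    rw [Finset.sum_comm]
    refine Finset.sum_congr rfl fun i _ => Finset.sum_congr rfl fun j _ => ?_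
    by_cases h : i < j
    · simp only [h, if_true, hA i j, hL i j, neg_mul_neg]
    · simp only [h, if_false]
  rw [Finset.sum_congr rfl fun i _ => Finset.sum_congr rfl fun j _ => hsplit i j,
    Finset.sum_congr rfl fun i _ => Finset.sum_add_distrib, Finset.sum_add_distrib, hswap, two_mul]

/-- Over `ℤ`: for `L` skew with zero diagonal, `Σ_{i,j} A_{ij} L_{ij} = − tr(A L)`. [this work] -/
theorem tps_sum_eq_neg_trace {n : ℕ} (A L : Matrix (Fin n) (Fin n) ℤ) (hL : ∀ i j, L j i = -L i j) :
    (∑ i, ∑ j, A i j * L i j) = -(A * L).trace := by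
  simp only [Matrix.trace, Matrix.diag_apply, Matrix.mul_apply]
  rw [← Finset.sum_neg_distrib]
  refine Finset.sum_congr rfl fun i _ => ?_
  rw [← Finset.sum_neg_distrib]
  refine Finset.sum_congr rfl fun j _ => ?_
  rw [hL j i]; ring

/-- **Symplectic pairing parity.**  For an alternating `n × n` matrix `M` over `𝔽₂` (symmetric with zero diagonal), `n = 2m`, and any
`B` with `B M = 1`: `Σ_{i<j} B_{ij} M_{ij} = m (mod 2)` — the canonical pairing of `M⁻¹` (a bivector) with `M` (a 2-form) counts the
hyperbolic pairs.  Proof by lifting to a skew-symmetric integer matrix and its adjugate (see the module docstring). [this work] -/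
theorem tps_pairing_inverse_alternating {n : ℕ} (m : ℕ) (hn : n = 2 * m) (M B : Matrix (Fin n) (Fin n) (ZMod 2))
    (hMs : Mᵀ = M) (hMd : ∀ i, M i i = 0) (hBM : B * M = 1) :
    (∑ i, ∑ j, (if i < j then B i j * M i j else 0)) = (m : ZMod 2) := by
  classical
  rcases Nat.eq_zero_or_pos m with hm0 | hmpos
  · subst hm0
    subst hn
    simp
  have hMsym : ∀ i j, M j i = M i j := fun i j => by
    simpa [Matrix.transpose_apply] using congrFun (congrFun hMs i) j
  -- the skew-symmetric integer lift
  set L : Matrix (Fin n) (Fin n) ℤ := Matrix.of fun i j =>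
    if i < j then ((M i j).val : ℤ) else if j < i then -((M j i).val : ℤ) else 0 with hLdef
  have hLapply : ∀ i j, L i j = if i < j then ((M i j).val : ℤ) else if j < i then -((M j i).val : ℤ) else 0 := fun i j => rfl
  have hLskew : ∀ i j, L j i = -L i j := by
    intro i j
    rw [hLapply, hLapply]
    rcases lt_trichotomy i j with h | h | h
    · rw [if_neg (lt_asymm h), if_pos h, if_pos h]
    · subst h; rw [if_neg (lt_irrefl _), if_neg (lt_irrefl _), neg_zero]
    · rw [if_pos h, if_neg (lt_asymm h), if_pos h, neg_neg]
  have hLt : Lᵀ = -L := by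
    ext i j
    simp only [Matrix.transpose_apply, Matrix.neg_apply]
    exact hLskew i j
  set f : ℤ →+* ZMod 2 := Int.castRingHom (ZMod 2) with hfdef
  have hneg : ∀ x : ZMod 2, -x = x := fun x => CharTwo.neg_eq x
  have hLM : L.map f = M := by
    ext i j
    simp only [Matrix.map_apply, hLapply]
    rcases lt_trichotomy i j with h | h | h
    · rw [if_pos h, hfdef]; simp
    · subst h; rw [if_neg (lt_irrefl _), if_neg (lt_irrefl _), map_zero, hMd]
    · rw [if_neg (lt_asymm h), if_pos h, map_neg, hneg, hfdef, ← hMsym j i]; simp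
  -- `det M = 1`, so `det L` is odd
  have h01 : ∀ x : ZMod 2, x = 0 ∨ x = 1 := by decide
  have hdetM : M.det = 1 := by
    have h := congrArg Matrix.det hBM
    rw [Matrix.det_mul, Matrix.det_one] at h
    rcases h01 M.det with h0 | h1
    · rw [h0, mul_zero] at h; exact absurd h zero_ne_one
    · exact h1
  have hdetL : f L.det = 1 := by
    rw [RingHom.map_det, RingHom.mapMatrix_apply, hLM, hdetM]
  -- the adjugate: reduces to `B`, is skew with zero diagonal
  set A : Matrix (Fin n) (Fin n) ℤ := L.adjugate with hAdef
  have hMB : M * B = 1 := mul_eq_one_comm.mp hBM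
  have hadjM : M.adjugate = B := by
    have h1 : M * M.adjugate = 1 := by rw [Matrix.mul_adjugate, hdetM, one_smul]
    calc M.adjugate = (B * M) * M.adjugate := by rw [hBM, Matrix.one_mul]
      _ = B * (M * M.adjugate) := by rw [Matrix.mul_assoc]
      _ = B := by rw [h1, Matrix.mul_one]
  have hAB : A.map f = B := by
    have h := RingHom.map_adjugate f L
    rw [RingHom.mapMatrix_apply, RingHom.mapMatrix_apply, hLM, hadjM] at h
    exact h
  have hcard : Fintype.card (Fin n) - 1 = 2 * m - 1 := by rw [Fintype.card_fin, hn]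
  have hodd : Odd (2 * m - 1) := ⟨m - 1, by omega⟩
  have hAt : Aᵀ = -A := by
    rw [hAdef, Matrix.adjugate_transpose, hLt, show -L = (-1 : ℤ) • L by simp, Matrix.adjugate_smul, hcard, hodd.neg_one_pow]
    simp
  have hAskew : ∀ i j, A j i = -A i j := fun i j => by
    have := congrFun (congrFun hAt i) j
    simpa [Matrix.transpose_apply, Matrix.neg_apply] using this
  have hAd : ∀ i, A i i = 0 := fun i => by have := hAskew i i; omega
  -- the integer identity `Σ_{i<j} A_{ij} L_{ij} = -m · det L`
  have htr : (A * L).trace = (n : ℤ) * L.det := by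
    rw [hAdef, Matrix.adjugate_mul, Matrix.trace_smul, Matrix.trace_one, Fintype.card_fin, smul_eq_mul, mul_comm]
  have hkey : (∑ i, ∑ j, (if i < j then A i j * L i j else 0)) = -(m : ℤ) * L.det := by
    have h2 := tps_sum_eq_two_mul_half A L hAskew hLskew hAd
    rw [tps_sum_eq_neg_trace A L hLskew, htr] at h2
    have hn' : (n : ℤ) = 2 * (m : ℤ) := by exact_mod_cast hn
    rw [hn'] at h2
    linarith
  -- reduce mod 2
  have hred := congrArg f hkey
  rw [map_sum] at hred
  simp only [map_sum] at hred
  have hlhs : (∑ i, ∑ j, f (if i < j then A i j * L i j else 0)) = ∑ i, ∑ j, (if i < j then B i j * M i j else 0) := by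
    refine Finset.sum_congr rfl fun i _ => Finset.sum_congr rfl fun j _ => ?_
    split_ifs with h
    · rw [map_mul, ← hAB, ← hLM]; rfl
    · exact map_zero f
  rw [hlhs] at hred
  rw [hred, map_mul, map_neg, map_natCast, hdetL, mul_one, hneg]

/-! ### The canonical pairing `⟨X, Y⟩ = Σ_{i<j} X_{ij} Y_{ij}` on alternating matrices: decomposable bivectors and `GL`-adjointness -/

/-- **Pairing with a decomposable bivector.**  For `Y` symmetric with zero diagonal (any commutative ring) and vectors `u, v`:
`Σ_{i<j} (u_i v_j + v_i u_j) Y_{ij} = uᵀ Y v` — the pairing of the bivector `u ∧ v` with the 2-form `Y` is `Y(u,v)`. [this work] -/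
theorem tps_pairing_wedge {R : Type*} [CommRing R] {n : ℕ} (Y : Matrix (Fin n) (Fin n) R)
    (hYs : ∀ i j, Y j i = Y i j) (hYd : ∀ i, Y i i = 0) (u v : Fin n → R) :
    (∑ i, ∑ j, (if i < j then (u i * v j + v i * u j) * Y i j else 0)) = ∑ i, ∑ j, u i * Y i j * v j := by
  -- split the right-hand side into `i<j`, `j<i`, `i=j`
  have hsplit : ∀ i j, u i * Y i j * v j =
      (if i < j then u i * Y i j * v j else 0) + (if j < i then u i * Y i j * v j else 0) := by
    intro i j
    rcases lt_trichotomy i j with h | h | h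
    · rw [if_pos h, if_neg (lt_asymm h), add_zero]
    · subst h; rw [if_neg (lt_irrefl _), hYd, mul_zero, zero_mul, add_zero]
    · rw [if_neg (lt_asymm h), if_pos h, zero_add]
  have hswap : (∑ i, ∑ j, (if j < i then u i * Y i j * v j else 0)) = ∑ i, ∑ j, (if i < j then v i * Y i j * u j else 0) := by
    rw [Finset.sum_comm]
    refine Finset.sum_congr rfl fun i _ => Finset.sum_congr rfl fun j _ => ?_
    by_cases h : i < j
    · rw [if_pos h, if_pos h, hYs i j]; ring
    · rw [if_neg h, if_neg h]
  rw [Finset.sum_congr rfl fun i _ => Finset.sum_congr rfl fun j _ => hsplit i j,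
    Finset.sum_congr rfl fun i _ => Finset.sum_add_distrib, Finset.sum_add_distrib, hswap, ← Finset.sum_add_distrib]
  refine Finset.sum_congr rfl fun i _ => ?_
  rw [← Finset.sum_add_distrib]
  refine Finset.sum_congr rfl fun j _ => ?_
  split_ifs with h
  · ring
  · simp

/-- **`GL`-adjointness of the pairing.**  For alternating `X, Y` (symmetric, zero diagonal; any commutative ring) and any square `Q`:
`⟨Q X Qᵀ, Y⟩ = ⟨X, Qᵀ Y Q⟩`.  With `Q = P⁻¹` this is the invariance of the bivector/2-form pairing under the change of frame
`Y ↦ Pᵀ Y P`, `X ↦ P⁻¹ X P⁻ᵀ` — the fact that makes "the cubic part has a pairing partner" frame-independent. [this work] -/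
theorem tps_pairing_conj {R : Type*} [CommRing R] {n : ℕ} (X Y Q : Matrix (Fin n) (Fin n) R)
    (hXs : ∀ i j, X j i = X i j) (hXd : ∀ i, X i i = 0) (hYs : ∀ i j, Y j i = Y i j) (hYd : ∀ i, Y i i = 0) :
    (∑ i, ∑ j, (if i < j then (Q * X * Qᵀ) i j * Y i j else 0)) =
      ∑ i, ∑ j, (if i < j then X i j * (Qᵀ * Y * Q) i j else 0) := by
  -- `T a b := Σ_{i<j} Q_{ia} Q_{jb} Y_{ij}`
  set T : Fin n → Fin n → R := fun a b => ∑ i, ∑ j, (if i < j then Q i a * Q j b * Y i j else 0) with hTdef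
  -- Step 1: the left side is `Σ_{a,b} X_{ab} T(a,b)`
  have h1 : (∑ i, ∑ j, (if i < j then (Q * X * Qᵀ) i j * Y i j else 0)) = ∑ a, ∑ b, X a b * T a b := by
    have hentry : ∀ i j, (if i < j then (Q * X * Qᵀ) i j * Y i j else 0) =
        ∑ a, ∑ b, X a b * (if i < j then Q i a * Q j b * Y i j else 0) := by
      intro i j
      by_cases h : i < j
      · simp only [h, if_true, Matrix.mul_apply, Matrix.transpose_apply, Finset.sum_mul]
        rw [Finset.sum_comm]
        refine Finset.sum_congr rfl fun a _ => Finset.sum_congr rfl fun b _ => ?_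
        ring
      · simp only [h, if_false, mul_zero, Finset.sum_const_zero]
    rw [Finset.sum_congr rfl fun i _ => Finset.sum_congr rfl fun j _ => hentry i j]
    rw [show (∑ i, ∑ j, ∑ a, ∑ b, X a b * (if i < j then Q i a * Q j b * Y i j else 0)) =
        ∑ a, ∑ b, ∑ i, ∑ j, X a b * (if i < j then Q i a * Q j b * Y i j else 0) from by
      rw [Finset.sum_congr rfl fun i _ => Finset.sum_comm, Finset.sum_comm,
        Finset.sum_congr rfl fun a _ => Finset.sum_congr rfl fun i _ => Finset.sum_comm,
        Finset.sum_congr rfl fun a _ => Finset.sum_comm]]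
    refine Finset.sum_congr rfl fun a _ => Finset.sum_congr rfl fun b _ => ?_
    rw [hTdef, Finset.mul_sum]
    exact Finset.sum_congr rfl fun i _ => by rw [Finset.mul_sum]
  -- Step 2: symmetrise in `(a,b)` using that `X` is symmetric with zero diagonal
  have h2 : (∑ a, ∑ b, X a b * T a b) = ∑ a, ∑ b, (if a < b then X a b * (T a b + T b a) else 0) := by
    have hsplit : ∀ a b, X a b * T a b = (if a < b then X a b * T a b else 0) + (if b < a then X a b * T a b else 0) := by
      intro a b
      rcases lt_trichotomy a b with h | h | h
      · rw [if_pos h, if_neg (lt_asymm h), add_zero]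
      · subst h; rw [if_neg (lt_irrefl _), hXd, zero_mul, add_zero]
      · rw [if_neg (lt_asymm h), if_pos h, zero_add]
    have hswap : (∑ a, ∑ b, (if b < a then X a b * T a b else 0)) = ∑ a, ∑ b, (if a < b then X a b * T b a else 0) := by
      rw [Finset.sum_comm]
      refine Finset.sum_congr rfl fun a _ => Finset.sum_congr rfl fun b _ => ?_
      by_cases h : a < b
      · rw [if_pos h, if_pos h, hXs a b]
      · rw [if_neg h, if_neg h]
    rw [Finset.sum_congr rfl fun a _ => Finset.sum_congr rfl fun b _ => hsplit a b,
      Finset.sum_congr rfl fun a _ => Finset.sum_add_distrib, Finset.sum_add_distrib, hswap, ← Finset.sum_add_distrib]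
    refine Finset.sum_congr rfl fun a _ => ?_
    rw [← Finset.sum_add_distrib]
    refine Finset.sum_congr rfl fun b _ => ?_
    split_ifs <;> ring
  -- Step 3: `T(a,b) + T(b,a) = (Qᵀ Y Q)_{ab}` by the decomposable-bivector formula
  have h3 : ∀ a b, T a b + T b a = (Qᵀ * Y * Q) a b := by
    intro a b
    have hw := tps_pairing_wedge Y hYs hYd (fun i => Q i a) (fun i => Q i b)
    have hlhs : (∑ i, ∑ j, (if i < j then (Q i a * Q j b + Q i b * Q j a) * Y i j else 0)) = T a b + T b a := by
      simp only [hTdef, ← Finset.sum_add_distrib]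
      refine Finset.sum_congr rfl fun i _ => Finset.sum_congr rfl fun j _ => ?_
      split_ifs <;> ring
    have hrhs : (∑ i, ∑ j, Q i a * Y i j * Q j b) = (Qᵀ * Y * Q) a b := by
      simp only [Matrix.mul_apply, Matrix.transpose_apply, Finset.sum_mul]
      rw [Finset.sum_comm]
    rw [← hlhs, hw, hrhs]
  rw [h1, h2]
  refine Finset.sum_congr rfl fun a _ => Finset.sum_congr rfl fun b _ => ?_
  split_ifs with h
  · rw [h3]
  · rfl

/-- Bilinearity of the pairing in the form needed below: `⟨Σ_q α_q X_q, Σ_ψ β_ψ Y_ψ⟩ = Σ_q Σ_ψ α_q β_ψ ⟨X_q, Y_ψ⟩`. [this work] -/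
theorem tps_pairing_sum_sum {R : Type*} [CommRing R] {n m : ℕ} (α β : Fin m → R) (X Y : Fin m → Matrix (Fin n) (Fin n) R) :
    (∑ j, ∑ k, (if j < k then (∑ q, α q * X q j k) * (∑ ψ, β ψ * Y ψ j k) else 0)) =
      ∑ q, ∑ ψ, α q * β ψ * ∑ j, ∑ k, (if j < k then X q j k * Y ψ j k else 0) := by
  have hterm : ∀ j k : Fin n, (if j < k then (∑ q, α q * X q j k) * (∑ ψ, β ψ * Y ψ j k) else 0) =
      ∑ q, ∑ ψ, α q * β ψ * (if j < k then X q j k * Y ψ j k else 0) := by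
    intro j k
    by_cases h : j < k
    · simp only [h, if_true]
      rw [Finset.sum_mul_sum]
      refine Finset.sum_congr rfl fun q _ => Finset.sum_congr rfl fun ψ _ => ?_
      ring
    · simp only [h, if_false, mul_zero, Finset.sum_const_zero]
  rw [Finset.sum_congr rfl fun j _ => Finset.sum_congr rfl fun k _ => hterm j k]
  -- reorder `Σ_j Σ_k Σ_q Σ_ψ` to `Σ_q Σ_ψ Σ_j Σ_k`
  rw [Finset.sum_congr rfl fun j _ => Finset.sum_comm, Finset.sum_comm,
    Finset.sum_congr rfl fun q _ => Finset.sum_congr rfl fun j _ => Finset.sum_comm,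
    Finset.sum_congr rfl fun q _ => Finset.sum_comm]
  refine Finset.sum_congr rfl fun q _ => Finset.sum_congr rfl fun ψ _ => ?_
  rw [Finset.mul_sum]
  exact Finset.sum_congr rfl fun j _ => by rw [Finset.mul_sum]

/-- `Qᵀ Y Q` is symmetric when `Y` is. [this work] -/
theorem tps_conj_symm {R : Type*} [CommRing R] {n : ℕ} (Y Q : Matrix (Fin n) (Fin n) R) (hYs : ∀ i j, Y j i = Y i j) (i j : Fin n) :
    (Qᵀ * Y * Q) j i = (Qᵀ * Y * Q) i j := by
  have hY : Yᵀ = Y := by ext a b; exact hYs a b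
  have ht : (Qᵀ * Y * Q)ᵀ = Qᵀ * Y * Q := by
    rw [Matrix.transpose_mul, Matrix.transpose_mul, Matrix.transpose_transpose, hY, Matrix.mul_assoc]
  simpa [Matrix.transpose_apply] using congrFun (congrFun ht i) j

/-- Over `𝔽₂`, `Qᵀ Y Q` has zero diagonal when `Y` is symmetric with zero diagonal (alternating forms pull back to alternating forms):
`Σ_{a,b} Q_{ai} Y_{ab} Q_{bi}` pairs off under `(a,b) ↦ (b,a)`. [this work] -/
theorem tps_conj_diag_zero {n : ℕ} (Y Q : Matrix (Fin n) (Fin n) (ZMod 2)) (hYs : ∀ i j, Y j i = Y i j) (hYd : ∀ i, Y i i = 0)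
    (i : Fin n) : (Qᵀ * Y * Q) i i = 0 := by
  simp only [Matrix.mul_apply, Matrix.transpose_apply, Finset.sum_mul]
  rw [← Finset.sum_product' (s := univ) (t := univ) (f := fun b a => Q a i * Y a b * Q b i)]
  refine Finset.sum_involution (fun x _ => (x.2, x.1)) ?_ ?_ ?_ ?_
  · intro x _
    have : Q x.1 i * Y x.1 x.2 * Q x.2 i = Q x.2 i * Y x.2 x.1 * Q x.1 i := by rw [hYs x.2 x.1]; ring
    rw [this]
    exact CharTwo.add_self_eq_zero _
  · rintro ⟨b, a⟩ _ hne
    simp only [ne_eq, Prod.mk.injEq, not_and]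
    intro hab
    subst hab
    exact absurd (by rw [hYd]; ring) hne
  · intro x _
    exact mem_product.mpr ⟨mem_univ _, mem_univ _⟩
  · intro x _
    rfl

/-- **Frame covariance of the pairing-partner equations.**  Let `c` (a 3-vector) and `d` (a 3-form) be given by totally symmetric
coefficient functions with vanishing diagonals (alternating tensors in characteristic `2`; only symmetry and zero diagonal of the SLICES
`c p`, `d φ` are needed), satisfying the partner equations `Σ_{j<k} c_{pjk} d_{φjk} = [p = φ]` in one frame.  For a change of frame
`P` with inverse `Pi` (`Pi P = 1`), the transformed tensors `c'_{pjk} = Σ Pi_{pq} Pi_{ja} Pi_{kb} c_{qab}` (contravariant) and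
`d'_{φjk} = Σ P_{ψφ} P_{aj} P_{bk} d_{ψab}` (covariant: `d'` is `d` evaluated on the new basis vectors, the columns of `P`) satisfy the
same equations.  Hence "the cubic part admits a pairing partner" may be tested in ANY linear frame. [this work] -/
theorem tps_pair_covariant {n : ℕ} (c d : Fin n → Fin n → Fin n → ZMod 2)
    (hcs : ∀ p j k, c p k j = c p j k) (hcd : ∀ p j, c p j j = 0) (hds : ∀ φ j k, d φ k j = d φ j k) (hdd : ∀ φ j, d φ j j = 0)
    (hpair : ∀ p φ, (∑ j, ∑ k, (if j < k then c p j k * d φ j k else 0)) = if p = φ then 1 else 0)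
    (P Pi : Matrix (Fin n) (Fin n) (ZMod 2)) (hPi : Pi * P = 1) (p φ : Fin n) :
    (∑ j, ∑ k, (if j < k then (∑ q, ∑ a, ∑ b, Pi p q * Pi j a * Pi k b * c q a b) *
        (∑ ψ, ∑ a, ∑ b, P ψ φ * P a j * P b k * d ψ a b) else 0)) = if p = φ then 1 else 0 := by
  have hPPi : P * Pi = 1 := mul_eq_one_comm.mp hPi
  -- the slices as matrices
  set C : Fin n → Matrix (Fin n) (Fin n) (ZMod 2) := fun q => Matrix.of fun a b => c q a b with hC
  set D : Fin n → Matrix (Fin n) (Fin n) (ZMod 2) := fun ψ => Matrix.of fun a b => d ψ a b with hD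
  have hC' : ∀ q j k, (∑ a, ∑ b, Pi p q * Pi j a * Pi k b * c q a b) = Pi p q * (Pi * C q * Piᵀ) j k := by
    intro q j k
    simp only [hC, Matrix.mul_apply, Matrix.transpose_apply, Matrix.of_apply, Finset.sum_mul, Finset.mul_sum]
    rw [Finset.sum_comm]
    refine Finset.sum_congr rfl fun a _ => Finset.sum_congr rfl fun b _ => ?_
    ring
  have hD' : ∀ ψ j k, (∑ a, ∑ b, P ψ φ * P a j * P b k * d ψ a b) = P ψ φ * (Pᵀ * D ψ * P) j k := by
    intro ψ j k
    simp only [hD, Matrix.mul_apply, Matrix.transpose_apply, Matrix.of_apply, Finset.sum_mul, Finset.mul_sum]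
    rw [Finset.sum_comm]
    refine Finset.sum_congr rfl fun a _ => Finset.sum_congr rfl fun b _ => ?_
    ring
  have hlhs : (∑ j, ∑ k, (if j < k then (∑ q, ∑ a, ∑ b, Pi p q * Pi j a * Pi k b * c q a b) *
        (∑ ψ, ∑ a, ∑ b, P ψ φ * P a j * P b k * d ψ a b) else 0)) =
      ∑ j, ∑ k, (if j < k then (∑ q, Pi p q * (fun q => Pi * C q * Piᵀ) q j k) *
        (∑ ψ, P ψ φ * (fun ψ => Pᵀ * D ψ * P) ψ j k) else 0) := by
    refine Finset.sum_congr rfl fun j _ => Finset.sum_congr rfl fun k _ => ?_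
    simp only [hC', hD']
  rw [hlhs, tps_pairing_sum_sum]
  -- each term: `⟨Pi C_q Piᵀ, Pᵀ D_ψ P⟩ = ⟨C_q, D_ψ⟩ = [q = ψ]`
  have hconj : ∀ q ψ, (∑ j, ∑ k, (if j < k then (Pi * C q * Piᵀ) j k * (Pᵀ * D ψ * P) j k else 0)) = if q = ψ then 1 else 0 := by
    intro q ψ
    rw [tps_pairing_conj (C q) (Pᵀ * D ψ * P) Pi (fun i j => hcs q i j) (fun i => hcd q i)]
    · have hback : Piᵀ * (Pᵀ * D ψ * P) * Pi = D ψ := by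
        calc Piᵀ * (Pᵀ * D ψ * P) * Pi = (P * Pi)ᵀ * D ψ * (P * Pi) := by
              rw [Matrix.transpose_mul]; simp only [Matrix.mul_assoc]
          _ = D ψ := by rw [hPPi, Matrix.transpose_one, Matrix.one_mul, Matrix.mul_one]
      rw [hback, ← hpair q ψ]
      rfl
    · exact fun i j => tps_conj_symm (D ψ) P (fun a b => hds ψ a b) i j
    · exact fun i => tps_conj_diag_zero (D ψ) P (fun a b => hds ψ a b) (fun a => hdd ψ a) i
  simp_rw [hconj]
  simp only [mul_ite, mul_one, mul_zero, Finset.sum_ite_eq, Finset.mem_univ, if_true]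
  -- `Σ_q Pi_{pq} P_{qφ} = (Pi P)_{pφ}`
  have := congrFun (congrFun hPi p) φ
  simpa [Matrix.mul_apply, Matrix.one_apply] using this

end Summit.QuantumAdvantage.QuantumAdvantage.Theorems.CubicForrelation.NearExactIsExact
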